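import Summits.MatrixMultiplication.OmegaCensus.DominoZpZpStructFiveCheck
import HarnessLib

/-!
# Structural cover theorem for part size `5` on `ZMod p × ZMod p`: normalised tuples, table check, assembly

ω-census `pub-omega`, family (b3), seat pub-omega-group gen 23.  Framing: lottery ticket; floor = certified bounds/negative
ranges.  VALUE: with `DominoZpZpStructFiveCore/Check.lean`, replaces a per-prime kernel enumeration of part size `5` (for
`p = 19`: hundreds of thousands of nodes, never attempted) by a table of the `≈ p³/6` normalised repeated count vectors that are
not excluded and a `p³ + p² + p + 2`-lookup completeness check; NOT progress on ω.  Pattern of `DominoZpZpStructFour.lean`.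

A GOOD quintuple of line values (`exists_goodP`: `a₀ = a₁`, key not in the excluded list `E`) scaled by a unit `κ` is one of
the NORMALISED REPEATED tuples `(1,1,b,c,e)`, `(0,0,1,c,e)`, `(0,0,0,1,e)`, `(0,0,0,0,1)`, `(0,0,0,0,0)` whose count vector is
not in `E` (`E` is closed under unit scalings).  `checkFive p EC tt` (`EC` = the codes of `E`) checks that the key tree `tt` of a certified line table
contains the count vector (`cv5`, code `polyBE 6`) of every normalised tuple unless that vector is in `E`;
`exists_entry_structFive` then yields, for EVERY value function of sum `5` on the `p²` points, a direction `j ≤ p`, a unit `k`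
and a table entry `e` with `e.1[(k·v) % p] =` the count along `j` at `v` — the scaled cover hypothesis consumed by
`DominoZpZpCells.no_law_cube_1de_of_onto_zpzp_of_cover`.  Per-prime instances: `DominoZqStructFiveTable*.lean` +
`DominoZqZqStructFiveCells.lean` (the latter decide `hE1`, `hE1'`, `hE2`, `hR`, `checkH3`, `checkFive`).
-/

namespace Summit.MatrixMultiplication.OmegaCensus

open Finset

namespace ZpZpDomino

/-! ## Normalised repeated tuples, the table check, and its soundness -/

section Table

/-- One normalised tuple is fine if its count-vector code is excluded (in `EC`) or a key of the tree. [folklore] -/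
def okFive (p : ℕ) (EC : List ℕ) (tt : BTree) (n₀ n₁ n₂ n₃ n₄ : ℕ) : Bool :=
  let cd := hornerS 6 (cv5 p n₀ n₁ n₂ n₃ n₄) 0
  EC.contains cd || tt.mem cd

/-- Row `b` of the completeness check: the tuples `(1,1,b,c,e)`, `c, e < p`. [folklore] -/
def checkFiveRow (p : ℕ) (EC : List ℕ) (tt : BTree) (b : ℕ) : Bool :=
  (List.range p).all fun c => (List.range p).all fun e => okFive p EC tt 1 1 b c e

/-- The remaining normalised tuples `(0,0,1,c,e)`, `(0,0,0,1,e)`, `(0,0,0,0,1)`, `(0,0,0,0,0)`. [folklore] -/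
def checkFiveRest (p : ℕ) (EC : List ℕ) (tt : BTree) : Bool :=
  ((List.range p).all fun c => (List.range p).all fun e => okFive p EC tt 0 0 1 c e) &&
    (((List.range p).all fun e => okFive p EC tt 0 0 0 1 e) && (okFive p EC tt 0 0 0 0 1 && okFive p EC tt 0 0 0 0 0))

/-- **Completeness check of a table tree against the normalised repeated quintuples** (`p³ + p² + p + 2` lookups):
`(1,1,b,c,e)`, `(0,0,1,c,e)`, `(0,0,0,1,e)`, `(0,0,0,0,1)`, `(0,0,0,0,0)` — each either excluded (code in `EC`, the codes of
the excluded list) or a key of the tree. [folklore] -/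
def checkFive (p : ℕ) (EC : List ℕ) (tt : BTree) : Bool :=
  ((List.range p).all fun b => checkFiveRow p EC tt b) && checkFiveRest p EC tt

/-- Assembling `checkFive` from its rows (the per-prime files may decide the rows separately). [folklore] -/
theorem checkFive_of_rows {p : ℕ} {EC : List ℕ} {tt : BTree} (hrows : ∀ b < p, checkFiveRow p EC tt b = true)
    (hrest : checkFiveRest p EC tt = true) : checkFive p EC tt = true := by
  rw [checkFive, Bool.and_eq_true, List.all_eq_true]
  exact ⟨fun b hb => hrows b (List.mem_range.1 hb), hrest⟩

/-- Well-formedness of the excluded list (lengths `p`, digits `< 6`), so that codes identify keys. [folklore] -/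
def checkEwf (p : ℕ) (E : List (List ℕ)) : Bool := E.all fun k => (k.length == p) && k.all fun x => decide (x < 6)

/-- **A successful lookup yields a table entry with that key.** [folklore] -/
theorem entry_of_lookup5 {p : ℕ} {T : List (List ℕ × List (ℕ × List ℕ))} {tt : BTree}
    (htt : ∀ x, tt.mem x = true → x ∈ T.map fun e => polyBE 6 e.1) (hWF : tabWF p 6 T = true) {n₀ n₁ n₂ n₃ n₄ : ℕ}
    (h : tt.mem (hornerS 6 (cv5 p n₀ n₁ n₂ n₃ n₄) 0) = true) : ∃ e ∈ T, e.1 = cv5 p n₀ n₁ n₂ n₃ n₄ := by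
  rw [hornerS_zero] at h
  have h2 := htt _ h
  rw [List.mem_map] at h2
  obtain ⟨e, he, hcode⟩ := h2
  simp only [tabWF, List.all_eq_true, Bool.and_eq_true, beq_iff_eq, decide_eq_true_eq] at hWF
  obtain ⟨helen, hedig⟩ := hWF e he
  refine ⟨e, he, polyBE_inj (by rw [helen, length_cv5]) hedig (fun x hx => ?_) hcode⟩
  simp only [cv5, List.mem_map, List.mem_range] at hx
  obtain ⟨w, -, rfl⟩ := hx
  exact Nat.lt_succ_of_le (cnt5_le _ _ _ _ _ _)

/-- From `excluded-or-found` and `not excluded` to `found` (codes identify well-formed keys). [folklore] -/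
theorem lookup_of_not_exc {p : ℕ} {E : List (List ℕ)} (hEwf : checkEwf p E = true) {tt : BTree} {n₀ n₁ n₂ n₃ n₄ : ℕ}
    (hk : cv5 p n₀ n₁ n₂ n₃ n₄ ∉ E) (h : okFive p (E.map (polyBE 6)) tt n₀ n₁ n₂ n₃ n₄ = true) :
    tt.mem (hornerS 6 (cv5 p n₀ n₁ n₂ n₃ n₄) 0) = true := by
  rw [okFive] at h
  simp only [Bool.or_eq_true, hornerS_zero] at h ⊢
  refine h.resolve_left fun hc => hk ?_
  rw [List.contains_iff_mem, List.mem_map] at hc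
  obtain ⟨k, hkE, hcode⟩ := hc
  simp only [checkEwf, List.all_eq_true, Bool.and_eq_true, beq_iff_eq, decide_eq_true_eq] at hEwf
  obtain ⟨hlen, hdig⟩ := hEwf k hkE
  have e : k = cv5 p n₀ n₁ n₂ n₃ n₄ :=
    polyBE_inj (by rw [hlen, length_cv5]) hdig (fun x hx => by
      simp only [cv5, List.mem_map, List.mem_range] at hx
      obtain ⟨w, -, rfl⟩ := hx
      exact Nat.lt_succ_of_le (cnt5_le _ _ _ _ _ _)) hcode
  exact e ▸ hkE

variable {p : ℕ} [Fact p.Prime]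

/-- The scaled count function read at `κ·v` is the count function of the original values at `v`. [folklore] -/
theorem cnt5_scaled {κ : ZMod p} (hκ : κ ≠ 0) (a₀ a₁ a₂ a₃ a₄ v : ZMod p) :
    cnt5 (κ * a₀).val (κ * a₁).val (κ * a₂).val (κ * a₃).val (κ * a₄).val (κ * v).val =
      (if a₀ = v then 1 else 0) + (if a₁ = v then 1 else 0) + (if a₂ = v then 1 else 0) + (if a₃ = v then 1 else 0) +
        (if a₄ = v then 1 else 0) := by
  unfold cnt5
  simp only [(ZMod.val_injective p).eq_iff, mul_right_inj' hκ]

/-- From a table entry keyed by the scaled values to the count identity at every `v`. [folklore] -/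
theorem getD_entry_scaled5 {κ : ZMod p} (hκ : κ ≠ 0) (a₀ a₁ a₂ a₃ a₄ : ZMod p) {e : List ℕ × List (ℕ × List ℕ)}
    (he : e.1 = cv5 p (κ * a₀).val (κ * a₁).val (κ * a₂).val (κ * a₃).val (κ * a₄).val) (v : ZMod p) :
    e.1.getD (κ * v).val 0 =
      (if a₀ = v then 1 else 0) + (if a₁ = v then 1 else 0) + (if a₂ = v then 1 else 0) + (if a₃ = v then 1 else 0) +
        (if a₄ = v then 1 else 0) := by
  rw [he, getD_cv5 p _ _ _ _ _ (ZMod.val_lt _), cnt5_scaled hκ]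

/-- The count vector of the scaled tuple is the key of `κ·a`. [folklore] -/
theorem cv5_scaled_eq_key5 (κ : ZMod p) (a : Fin 5 → ZMod p) :
    cv5 p (κ * a 0).val (κ * a 1).val (κ * a 2).val (κ * a 3).val (κ * a 4).val = key5 (fun i => κ * a i) := rfl

/-- **Normalisation**: a GOOD quintuple (`a 0 = a 1`, key not excluded), scaled by a suitable unit `κ`, is one of the normalised
repeated tuples with a non-excluded count vector, so a table that passes `checkFive` has an entry keyed by it. [folklore] -/
theorem exists_entry_of_goodP {E : List (List ℕ)} (hE2 : ∀ k ∈ E, ∀ κ : ℕ, 1 ≤ κ → κ < p → scaleVec p κ k ∈ E)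
    {T : List (List ℕ × List (ℕ × List ℕ))} {tt : BTree}
    (htt : ∀ x, tt.mem x = true → x ∈ T.map fun e => polyBE 6 e.1) (hWF : tabWF p 6 T = true)
    (hEwf : checkEwf p E = true) (hchk : checkFive p (E.map (polyBE 6)) tt = true) {a : Fin 5 → ZMod p}
    (h01 : a 0 = a 1) (hgood : key5 a ∉ E) :
    ∃ κ : ZMod p, κ ≠ 0 ∧ ∃ e ∈ T, ∀ v : ZMod p, e.1.getD (κ * v).val 0 =
      (if a 0 = v then 1 else 0) + (if a 1 = v then 1 else 0) + (if a 2 = v then 1 else 0) + (if a 3 = v then 1 else 0) +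
        (if a 4 = v then 1 else 0) := by
  have hp1 : Fact (1 < p) := ⟨(Fact.out : p.Prime).one_lt⟩
  simp only [checkFive, checkFiveRow, checkFiveRest, Bool.and_eq_true, List.all_eq_true, List.mem_range] at hchk
  obtain ⟨hA, hB, hC, hD, hD0⟩ := hchk
  -- the scaled key is never excluded
  have hne : ∀ κ : ZMod p, κ ≠ 0 →
      cv5 p (κ * a 0).val (κ * a 1).val (κ * a 2).val (κ * a 3).val (κ * a 4).val ∉ E := fun κ hκ hmem => by
    rw [cv5_scaled_eq_key5] at hmem
    exact hgood (key5_mem_of_smul_mem hE2 hκ a hmem)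
  -- case analysis on the normal form
  by_cases ha₀ : a 0 = 0
  · have ha₁ : a 1 = 0 := h01 ▸ ha₀
    by_cases ha₂ : a 2 = 0
    · by_cases ha₃ : a 3 = 0
      · by_cases ha₄ : a 4 = 0
        · -- (0,0,0,0,0)
          have hk := hne 1 one_ne_zero
          rw [ha₀, ha₁, ha₂, ha₃, ha₄, mul_zero, ZMod.val_zero] at hk
          obtain ⟨e, he, hkey⟩ := entry_of_lookup5 htt hWF (lookup_of_not_exc hEwf hk hD0)
          refine ⟨1, one_ne_zero, e, he, getD_entry_scaled5 one_ne_zero _ _ _ _ _ ?_⟩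
          rw [hkey, ha₀, ha₁, ha₂, ha₃, ha₄, mul_zero, ZMod.val_zero]
        · -- (0,0,0,0,1)
          have hk := hne (a 4)⁻¹ (inv_ne_zero ha₄)
          rw [ha₀, ha₁, ha₂, ha₃, mul_zero, ZMod.val_zero, inv_mul_cancel₀ ha₄, ZMod.val_one] at hk
          obtain ⟨e, he, hkey⟩ := entry_of_lookup5 htt hWF (lookup_of_not_exc hEwf hk hD)
          refine ⟨(a 4)⁻¹, inv_ne_zero ha₄, e, he, getD_entry_scaled5 (inv_ne_zero ha₄) _ _ _ _ _ ?_⟩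
          rw [hkey, ha₀, ha₁, ha₂, ha₃, mul_zero, ZMod.val_zero, inv_mul_cancel₀ ha₄, ZMod.val_one]
      · -- (0,0,0,1,e)
        have hk := hne (a 3)⁻¹ (inv_ne_zero ha₃)
        rw [ha₀, ha₁, ha₂, mul_zero, ZMod.val_zero, inv_mul_cancel₀ ha₃, ZMod.val_one] at hk
        obtain ⟨e, he, hkey⟩ := entry_of_lookup5 htt hWF (lookup_of_not_exc hEwf hk (hC _ (ZMod.val_lt _)))
        refine ⟨(a 3)⁻¹, inv_ne_zero ha₃, e, he, getD_entry_scaled5 (inv_ne_zero ha₃) _ _ _ _ _ ?_⟩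
        rw [hkey, ha₀, ha₁, ha₂, mul_zero, ZMod.val_zero, inv_mul_cancel₀ ha₃, ZMod.val_one]
    · -- (0,0,1,c,e)
      have hk := hne (a 2)⁻¹ (inv_ne_zero ha₂)
      rw [ha₀, ha₁, mul_zero, ZMod.val_zero, inv_mul_cancel₀ ha₂, ZMod.val_one] at hk
      obtain ⟨e, he, hkey⟩ :=
        entry_of_lookup5 htt hWF (lookup_of_not_exc hEwf hk (hB _ (ZMod.val_lt _) _ (ZMod.val_lt _)))
      refine ⟨(a 2)⁻¹, inv_ne_zero ha₂, e, he, getD_entry_scaled5 (inv_ne_zero ha₂) _ _ _ _ _ ?_⟩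
      rw [hkey, ha₀, ha₁, mul_zero, ZMod.val_zero, inv_mul_cancel₀ ha₂, ZMod.val_one]
  · -- (1,1,b,c,e)
    have hk := hne (a 0)⁻¹ (inv_ne_zero ha₀)
    rw [← h01, inv_mul_cancel₀ ha₀, ZMod.val_one] at hk
    obtain ⟨e, he, hkey⟩ :=
      entry_of_lookup5 htt hWF (lookup_of_not_exc hEwf hk (hA _ (ZMod.val_lt _) _ (ZMod.val_lt _) _ (ZMod.val_lt _)))
    refine ⟨(a 0)⁻¹, inv_ne_zero ha₀, e, he, getD_entry_scaled5 (inv_ne_zero ha₀) _ _ _ _ _ ?_⟩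
    rw [hkey, ← h01, inv_mul_cancel₀ ha₀, ZMod.val_one]

end Table


/-! ## Decidable forms of the hypotheses on the excluded list -/

section Checks

/-- Entries of excluded keys are `≤ 2`. [folklore] -/
def checkE1 (E : List (List ℕ)) : Bool := E.all fun k => k.all fun x => decide (x ≤ 2)

/-- At most one entry `2` in an excluded key. [folklore] -/
def checkE1' (p : ℕ) (E : List (List ℕ)) : Bool :=
  E.all fun k => (List.range p).all fun v => (List.range p).all fun w =>
    (v == w) || (!(k.getD v 0 == 2) || !(k.getD w 0 == 2))

/-- The excluded list is closed under unit scalings. [folklore] -/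
def checkE2 (p : ℕ) (E : List (List ℕ)) : Bool :=
  E.all fun k => (List.range p).all fun κ => (κ == 0) || E.contains (scaleVec p κ k)

/-- Every excluded key scales into the list of representatives. [folklore] -/
def checkR (p : ℕ) (E R : List (List ℕ)) : Bool :=
  E.all fun k => (List.range p).any fun κ => !(κ == 0) && R.contains (scaleVec p κ k)

/-- `checkE1` ⇒ `hE1`. [folklore] -/
theorem hE1_of_check {E : List (List ℕ)} (h : checkE1 E = true) : ∀ k ∈ E, ∀ x ∈ k, x ≤ 2 := by
  intro k hk x hx
  simp only [checkE1, List.all_eq_true, decide_eq_true_eq] at h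
  exact h k hk x hx

/-- `checkE1'` ⇒ `hE1'`. [folklore] -/
theorem hE1'_of_check {p : ℕ} {E : List (List ℕ)} (h : checkE1' p E = true) :
    ∀ k ∈ E, ∀ v < p, ∀ w < p, v ≠ w → k.getD v 0 = 2 → k.getD w 0 = 2 → False := by
  intro k hk v hv w hw hvw h1 h2
  simp only [checkE1', List.all_eq_true, List.mem_range, Bool.or_eq_true, beq_iff_eq, Bool.not_eq_true',
    beq_eq_false_iff_ne, ne_eq] at h
  rcases h k hk v hv w hw with e | e | e
  · exact hvw e
  · exact e h1
  · exact e h2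

/-- `checkE2` ⇒ `hE2`. [folklore] -/
theorem hE2_of_check {p : ℕ} {E : List (List ℕ)} (h : checkE2 p E = true) :
    ∀ k ∈ E, ∀ κ : ℕ, 1 ≤ κ → κ < p → scaleVec p κ k ∈ E := by
  intro k hk κ h1 hκ
  simp only [checkE2, List.all_eq_true, List.mem_range, Bool.or_eq_true, beq_iff_eq, List.contains_iff_mem] at h
  rcases h k hk κ hκ with e | e
  · omega
  · exact e

/-- `checkR` ⇒ `hR`. [folklore] -/
theorem hR_of_check {p : ℕ} {E R : List (List ℕ)} (h : checkR p E R = true) :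
    ∀ k ∈ E, ∃ κ : ℕ, 1 ≤ κ ∧ κ < p ∧ scaleVec p κ k ∈ R := by
  intro k hk
  simp only [checkR, List.all_eq_true, List.any_eq_true, List.mem_range, Bool.and_eq_true, Bool.not_eq_true',
    beq_eq_false_iff_ne, ne_eq, List.contains_iff_mem] at h
  obtain ⟨κ, hκ, h0, hR⟩ := h k hk
  exact ⟨κ, Nat.one_le_iff_ne_zero.2 h0, hκ, hR⟩

end Checks

/-! ## Assembly: the scaled cover hypothesis for part size `5` -/

section Assembly

variable {p : ℕ} [Fact p.Prime]

/-- **Structural cover theorem for part `5`.**  For a prime `p`, an excluded list `E` with representatives `R` passing the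
decidable hypotheses, and a certified table `T` whose key tree passes `checkFive`, every value function `g` of sum `5` on the
`p²` points has a direction `j ≤ p`, a unit `k` and an entry `e ∈ T` with `e.1[(k·v) % p] = (count of g along j at v)` — the
scaled cover hypothesis of `DominoZpZpCells.lean`. [folklore] -/
theorem exists_entry_structFive (E R : List (List ℕ)) (hE1 : ∀ k ∈ E, ∀ x ∈ k, x ≤ 2)
    (hE1' : ∀ k ∈ E, ∀ v < p, ∀ w < p, v ≠ w → k.getD v 0 = 2 → k.getD w 0 = 2 → False)
    (hE2 : ∀ k ∈ E, ∀ κ : ℕ, 1 ≤ κ → κ < p → scaleVec p κ k ∈ E)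
    (hR : ∀ k ∈ E, ∃ κ : ℕ, 1 ≤ κ ∧ κ < p ∧ scaleVec p κ k ∈ R) (hchk3 : checkH3 p (E.map (polyBE 6)) (allArr23 p R) R = true)
    (T : List (List ℕ × List (ℕ × List ℕ))) (tt : BTree)
    (htt : ∀ x, tt.mem x = true → x ∈ T.map fun e => polyBE 6 e.1) (hWF : tabWF p 6 T = true)
    (hEwf : checkEwf p E = true) (hchk : checkFive p (E.map (polyBE 6)) tt = true) (g : Fin (p * p) → ℕ)
    (hg : ∑ i, g i = 5) :
    ∃ j < p + 1, ∃ k : ℕ, k % p ≠ 0 ∧ ∃ e ∈ T, ∀ v < p,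
      e.1.getD (k * v % p) 0 = ∑ i : Fin (p * p), pick v (pv p j i.val) (g i) := by
  haveI : NeZero p := ⟨(Fact.out : p.Prime).ne_zero⟩
  set H : ZMod p × ZMod p → ℕ := fun w => g ((ptEquiv p).symm w) with hH
  have hsum : ∑ w, H w = 5 := by
    rw [← hg]
    exact Fintype.sum_equiv (ptEquiv p).symm H g fun w => rfl
  obtain ⟨u, hu⟩ := exists_tuple_of_sum_eq 5 H hsum
  obtain ⟨j, hj, σ, h01, hgood⟩ := exists_goodP E hE1 hE1' hE2 (h3_of_checkH3 E R hE2 hR hchk3) u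
  have hcnt : ∀ v < p, ∑ i : Fin (p * p), pick v (pv p j i.val) (g i) =
      ∑ i : Fin 5, if lineDir p j (u (σ i)) = ((v : ℕ) : ZMod p) then 1 else 0 := by
    intro v hv
    have e1 := sum_filter_eq_sum_pick p j H hv
    have e2 : ∀ i : Fin (p * p), H (pt p i.val) = g i := fun i => by
      show g ((ptEquiv p).symm (ptEquiv p i)) = g i
      rw [Equiv.symm_apply_apply]
    simp only [e2] at e1
    rw [← e1]
    simp only [hu]
    rw [sum_filter_tuple_count u (lineDir p j) ((v : ℕ) : ZMod p)]
    exact (Equiv.sum_comp σ (fun i => if lineDir p j (u i) = ((v : ℕ) : ZMod p) then 1 else 0)).symm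
  obtain ⟨κ, hκ, e, he, hev⟩ :=
    exists_entry_of_goodP hE2 htt hWF hEwf hchk (a := fun i => lineDir p j (u (σ i))) h01 hgood
  refine ⟨j, hj, κ.val, ?_, e, he, fun v hv => ?_⟩
  · rw [Nat.mod_eq_of_lt (ZMod.val_lt κ)]
    exact (ZMod.val_ne_zero κ).2 hκ
  · rw [hcnt v hv, Fin.sum_univ_five]
    have h1 := hev ((v : ℕ) : ZMod p)
    rw [ZMod.val_mul, ZMod.val_natCast, Nat.mod_eq_of_lt hv] at h1
    exact h1

/-- **Structural cover theorem for part `5`, all hypotheses on `E, R` as Bool checks** (the form the per-prime cells files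
decide). [folklore] -/
theorem exists_entry_structFive_of_checks (E R : List (List ℕ)) (h1 : checkE1 E = true) (h1' : checkE1' p E = true)
    (h2 : checkE2 p E = true) (hR : checkR p E R = true) (hchk3 : checkH3 p (E.map (polyBE 6)) (allArr23 p R) R = true)
    (T : List (List ℕ × List (ℕ × List ℕ))) (tt : BTree)
    (htt : ∀ x, tt.mem x = true → x ∈ T.map fun e => polyBE 6 e.1) (hWF : tabWF p 6 T = true)
    (hEwf : checkEwf p E = true) (hchk : checkFive p (E.map (polyBE 6)) tt = true) (g : Fin (p * p) → ℕ)
    (hg : ∑ i, g i = 5) :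
    ∃ j < p + 1, ∃ k : ℕ, k % p ≠ 0 ∧ ∃ e ∈ T, ∀ v < p,
      e.1.getD (k * v % p) 0 = ∑ i : Fin (p * p), pick v (pv p j i.val) (g i) :=
  exists_entry_structFive E R (hE1_of_check h1) (hE1'_of_check h1') (hE2_of_check h2) (hR_of_check hR) hchk3 T tt htt hWF
    hEwf hchk g hg

end Assembly

end ZpZpDomino

end Summit.MatrixMultiplication.OmegaCensus
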